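import Literature.Geometry.Kaehler.RiemannSurfaceHyperellipticAutomorphismGroupFinite
import Literature.Geometry.Kaehler.RiemannSurfaceAutomorphismFixedPointBound
import HarnessLib

/-!
# Compact Riemann surfaces of genus two: the hyperelliptic statements without hypothesis
# (Farkas–Kra III.7.2, III.7.9 Corollaries 1–3, III.7.11, V.1.2 Corollary 2 (Schwarz); Miranda VII 1.10)

Layer `Literature/Geometry/Kaehler`, sequel of `RiemannSurfaceRiemannRochApplications` (Proposition VII.1.10
`exists_degree_eq_two_of_arithGenus_eq_two`: a surface of genus two has a degree-`2` map to `ℂ_∞`),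
`RiemannSurfaceHyperellipticInvolution` / `RiemannSurfaceHyperellipticWeierstrassPoints` /
`RiemannSurfaceHyperellipticAutomorphismGroupFinite` (the hyperelliptic theory, stated for a given double
cover `F`) and `RiemannSurfaceAutomorphismFixedPointBound` (V.1.1). Farkas–Kra, *Riemann Surfaces*, GTM 71,
2nd ed. (1992), as printed: III.7.2 «every surface of genus 2 is hyperelliptic» (recalled in V.1.5 Corollary 2,
held copy p0227: «But in genus 2, every surface is hyperelliptic.»); III.7.3 «the hyperelliptic surfaces of
genus `g ≥ 2` [have] precisely `2g + 2` Weierstrass points» (the branch points); III.7.9 Corollaries 1–3 (the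
hyperelliptic involution `J`: its fixed points are the Weierstrass points, it is the unique involution with
`2g + 2` fixed points, it is central); III.7.11 «an element `T ∉ ⟨J⟩` has at most `4` fixed points»; V.1.2
Corollary 2 (Schwarz): «If `M` is a surface of genus `g ≥ 2`, then Aut `M` is a finite group.»

## What is proved

For `M` compact connected with `arithGenus M = 2` — NO double cover among the hypotheses — the genus-two
specialisations: there are exactly `6` Weierstrass points (`dim L(2p) ≥ 2`); there is a holomorphic
involution `J ≠ 1` with exactly `6` fixed points, namely the Weierstrass points, commuting with every
automorphism, such that every automorphism `T ∉ {1, J}` has at most `4` fixed points and an automorphism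
fixing the `6` Weierstrass points is `1` or `J`; every `T ≠ 1` has at most `6` fixed points (V.1.1); and
**Schwarz's theorem for genus two: the set of bijective holomorphic self-maps of `M` is finite**.

Everything is proved; no definitions, no named facts, no instances. NOT here: `|Aut M| ≤ 48`, the genus-two
surfaces as sextic double covers `w² = (z − e₁)⋯(z − e₆)` beyond `RiemannSurfaceHyperellipticEquation`.

## References

* H. M. Farkas, I. Kra, *Riemann Surfaces*, GTM 71, 2nd ed., Springer (1992), III.7.2, III.7.3, III.7.9
  Corollaries 1–3, III.7.11, V.1.1, V.1.2 Corollary 2, V.1.5 Corollary 2 (held copy p0227). [FarkasKra1992]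
* R. Miranda, *Algebraic Curves and Riemann Surfaces*, GSM 5, AMS (1995), Chapter VII Proposition 1.10,
  Corollary 4.16. [Miranda1995]
-/

noncomputable section

open scoped Manifold ContDiff Topology OnePoint
open Filter Function Set

namespace Literature.Geometry.Kaehler

namespace RiemannSurface

open RiemannSphere

variable {M : Type*} [TopologicalSpace M] [ChartedSpace ℂ M] [IsManifold 𝓘(ℂ, ℂ) ω M]
  [CompactSpace M] [T2Space M] [PreconnectedSpace M] [Nonempty M]

/-- **«in genus 2, every surface is hyperelliptic» ⇒ exactly `6` Weierstrass points.** [cite: FarkasKra1992, III.7.2, III.7.3; Miranda1995, Chapter VII Proposition 1.10] -/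
theorem ncard_weierstrass_eq_six_of_arithGenus_eq_two (h2 : arithGenus M = 2) :
    {p : M | 2 ≤ Module.finrank ℂ ↥(riemannRochSubmodule (Finsupp.single p (arithGenus M : ℤ)))}.Finite ∧
      {p : M | 2 ≤ Module.finrank ℂ ↥(riemannRochSubmodule (Finsupp.single p (arithGenus M : ℤ)))}.ncard = 6 := by
  obtain ⟨F, hF, -, hF2⟩ := exists_degree_eq_two_of_arithGenus_eq_two h2
  obtain ⟨hfin, hcard⟩ := ncard_setOf_two_le_finrank_riemannRochSubmodule_single_arithGenus hF hF2 (by omega)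
  exact ⟨hfin, by rw [hcard, h2]⟩

/-- **The hyperelliptic involution of a genus-two surface (III.7.9 and Corollaries 1, 3; III.7.11; V.1.2
Corollary 1)**: there is a holomorphic `J` with `J ∘ J = 1`, `J ≠ 1`, whose fixed points are exactly the `6`
Weierstrass points, commuting with every automorphism, such that every automorphism `T ∉ {1, J}` has at most
`4` fixed points and an automorphism fixing every Weierstrass point is `1` or `J`.
[cite: FarkasKra1992, III.7.9 Corollaries 1–3, III.7.11, V.1.2 Corollary 1, III.7.2] -/
theorem exists_involution_of_arithGenus_eq_two (h2 : arithGenus M = 2) :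
    ∃ J : M → M, MDifferentiable 𝓘(ℂ, ℂ) 𝓘(ℂ, ℂ) J ∧ J ∘ J = id ∧ J ≠ id ∧
      (∀ x, J x = x ↔ 2 ≤ Module.finrank ℂ ↥(riemannRochSubmodule (Finsupp.single x (arithGenus M : ℤ)))) ∧
      {x | J x = x}.ncard = 6 ∧
      (∀ T : M → M, MDifferentiable 𝓘(ℂ, ℂ) 𝓘(ℂ, ℂ) T → Bijective T → J ∘ T = T ∘ J) ∧
      (∀ T : M → M, MDifferentiable 𝓘(ℂ, ℂ) 𝓘(ℂ, ℂ) T → Bijective T → T ≠ id → T ≠ J →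
        {x | T x = x}.Finite ∧ {x | T x = x}.ncard ≤ 4) ∧
      (∀ T : M → M, MDifferentiable 𝓘(ℂ, ℂ) 𝓘(ℂ, ℂ) T → Bijective T →
        ((∀ x, 2 ≤ Module.finrank ℂ ↥(riemannRochSubmodule (Finsupp.single x (arithGenus M : ℤ))) → T x = x) ↔
          T = id ∨ T = J)) := by
  obtain ⟨F, hF, -, hF2⟩ := exists_degree_eq_two_of_arithGenus_eq_two h2
  have hg : 2 ≤ arithGenus M := by omega
  refine ⟨sheetInterchange F, mdifferentiable_sheetInterchange hF hF2,
    funext (sheetInterchange_sheetInterchange hF hF2), sheetInterchange_ne_id hF hF2,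
    fun x ↦ sheetInterchange_eq_self_iff_two_le_finrank hF hF2 hg x, ?_,
    fun T hT hTb ↦ sheetInterchange_comp_eq_comp hF hF2 hg hT hTb,
    fun T hT hTb h1 hJ ↦ ncard_setOf_apply_eq_self_le_four_of_ne hF hF2 hg hT hTb h1 hJ, fun T hT hTb ↦ ?_⟩
  · rw [(ncard_setOf_sheetInterchange_eq_self hF hF2).2, h2]
  · rw [← forall_apply_eq_self_iff_eq_id_or_eq_sheetInterchange hF hF2 hg hT hTb]
    simp only [← two_le_finrank_riemannRochSubmodule_single_arithGenus_iff_ramificationNumber_eq_two hF hF2 hg]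

/-- **PROPOSITION V.1.1 in genus two: a non-trivial automorphism has at most `6` fixed points.**
[cite: FarkasKra1992, V.1.1] -/
theorem ncard_setOf_apply_eq_self_le_six_of_arithGenus_eq_two (h2 : arithGenus M = 2) {T : M → M}
    (hT : MDifferentiable 𝓘(ℂ, ℂ) 𝓘(ℂ, ℂ) T) (hTb : Bijective T) (hT1 : ∃ x, T x ≠ x) :
    {x | T x = x}.Finite ∧ {x | T x = x}.ncard ≤ 6 := by
  obtain ⟨hfin, hle⟩ := ncard_setOf_apply_eq_self_le hT hTb hT1
  exact ⟨hfin, by omega⟩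

/-- **COROLLARY 2 (SCHWARZ) in genus two: the automorphisms of a compact Riemann surface of genus `2`
form a finite set** («in genus 2, every surface is hyperelliptic» and the hyperelliptic case of V.1.2
Corollary 2). [cite: FarkasKra1992, V.1.2 Corollary 2, III.7.2, V.1.5 Corollary 2 (proof)] -/
theorem finite_setOf_mdifferentiable_bijective_of_arithGenus_eq_two (h2 : arithGenus M = 2) :
    {T : M → M | MDifferentiable 𝓘(ℂ, ℂ) 𝓘(ℂ, ℂ) T ∧ Bijective T}.Finite := by
  obtain ⟨F, hF, -, hF2⟩ := exists_degree_eq_two_of_arithGenus_eq_two h2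
  exact finite_setOf_mdifferentiable_bijective hF hF2 (by omega)

end RiemannSurface

end Literature.Geometry.Kaehler

end
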